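import Literature.NumberTheory.GaloisCohomology.RestrictedRamificationEulerCharacteristicSES
import Literature.NumberTheory.GaloisRepresentations.ContinuousCohomologyTorsion
import Literature.NumberTheory.GaloisRepresentations.PPrimaryDevissage
import Mathlib.NumberTheory.Padics.PadicVal.Basic
import HarnessLib

/-!
# The additive (`p`-adic valuation) form of Tate's Euler characteristic at a totally complex field:
# `χ_{p,e}(M) = v_p #H⁰ − v_p #H¹ + v_p #H² + e·v_p #M ∈ ℤ` is additive in short exact sequences

Topic `NumberTheory/GaloisCohomology`; namespace `Literature.NumberTheory.GaloisCohomology`.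
THEOREMS ONLY (no definition, no named fact, no `sorry`, no instance; D-0026).  Lane «TATE-EPC-TC»
of cell `bsd-eis` (road memo evidence #54 on stmt-BirchSwinnertonDyer-19032), brick (B1d-γ); sequel
of `RestrictedRamificationEulerCharacteristicSES.lean`.

Milne, *Arithmetic Duality Theorems*, I §5 (proof of Thm. 5.1, p. 69): "`φ(M) = χ(G_S, M) ⋯` …
LEMMA 5.3. The map `φ` … is multiplicative in short exact sequences … `φ` therefore defines a
homomorphism `R_{𝔽_p}(Ḡ) → ℚ_{>0}`".  The lane's reduction bricks (B3: Artin induction + the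
lattice lemma `StableLatticeReductionInvariant`, B4: `p`-group filtration) consume `φ` as an
ADDITIVE invariant with values in an additive group.  For `p`-PRIMARY finite modules all the
groups `Hⁿ(G_S, M)` are finite `p`-groups, so nothing is lost by passing to `p`-adic valuations:
with `Hⁿ = restrictedCohomology ρ S n` and any exponent `e : ℕ` (`e = r₂(K)` is Tate's),

  `χ_{p,e}(ρ) := v_p #H⁰(G_S, M) − v_p #H¹(G_S, M) + v_p #H²(G_S, M) + e · v_p #M ∈ ℤ`

(spelled out with Mathlib's `padicValNat`; NO definition is introduced).

* §1 `isPrimaryTorsion_continuousCohomology`, `isPrimaryTorsion_restrictedCohomology` — the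
  cohomology of a `p`-primary discrete module is `p`-primary (Serre I §2.2 Cor. 3; the tree's
  `continuousCohomology_exists_pow_smul_eq_zero_of_span_singleton`); hence
  `exists_natCard_restrictedCohomology_eq_pow` (`#Hⁿ = p^k` when finite).
* §2 `padicValNat_euler_add_of_card_nineTerm` — the arithmetic: the cleared-denominator identity
  `(a₂c₂m₂^e)·b₁·b₃ = b₂·(a₁c₁m₁^e)·(a₃c₃m₃^e)` between non-zero naturals gives
  `χ₂ = χ₁ + χ₃` for `χᵢ = v aᵢ − v bᵢ + v cᵢ + e·v mᵢ`.
* §3 **`restrictedCohomology_eulerChar_add`** — `χ_{p,e}(ρ₂) = χ_{p,e}(ρ₁) + χ_{p,e}(ρ₃)` along a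
  short exact sequence of discrete `Γ_K`-modules `0 → M₁ → M₂ → M₃ → 0` with `M₂` finite and
  unramified outside the finite `S ⊇ S_p`, `M₁` `p`-primary, `K` totally complex, and
  `H²(G_S, M₁)`, `H²(G_S, M₂)` finite (Milne's Lemma 5.3 verbatim, additive notation).
* §4 **`restrictedCohomology_euler_iff_eulerChar_eq_zero`** — for `p`-primary finite `M` with
  `H²(G_S, M)` finite: Tate's identity `#H⁰·#H²·#M^e = #H¹` holds iff `χ_{p,e}(ρ) = 0` (all four
  cardinalities are powers of `p`).

## References
* J. S. Milne, *Arithmetic Duality Theorems*, 2nd ed. (2006), I §5 Thm. 5.1 and Lemma 5.3 (p. 69).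
  [MilneADT2006]
* J.-P. Serre, *Cohomologie galoisienne* / *Galois Cohomology* (1997), I §2.2 (Prop. 8, Cor. 3),
  II §5.4. [SerreGaloisCohomology1997]
-/

noncomputable section

open CategoryTheory Function NumberField Field IsDedekindDomain
open scoped NumberField

namespace Literature.NumberTheory.GaloisCohomology

open Literature.NumberTheory.GaloisRepresentations
open Literature.NumberTheory.GaloisRepresentations.DiscreteGaloisModule (restrictedCohomology)
open _root_.TopRep _root_.ContRepresentation _root_.ContinuousCohomology

/-! ### §1. The cohomology of a `p`-primary discrete module is `p`-primary -/

section Torsion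

/-- **`Hⁿ(Γ, A)` is `p`-primary for a `p`-primary discrete `Γ`-module `A`** (`Γ` compact; every
class is killed by a power of `p`). [cite: SerreGaloisCohomology1997, I §2.2 (Prop. 8, Cor. 3)] -/
theorem isPrimaryTorsion_continuousCohomology {Γ : Type} [Group Γ] [TopologicalSpace Γ]
    [IsTopologicalGroup Γ] [CompactSpace Γ] [LocallyCompactSpace Γ]
    {A : Type} [AddCommGroup A] [TopologicalSpace A] [DiscreteTopology A]
    (τ : ContinuousRep Γ ℤ A) {p : ℕ} (hA : IsPrimaryTorsion p A) (n : ℕ) :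
    IsPrimaryTorsion p (continuousCohomology n τ.toTopRep) := fun γ => by
  obtain ⟨m, hm⟩ := continuousCohomology_exists_pow_smul_eq_zero_of_span_singleton
    (k := ℤ) τ.toTopRep (p : ℤ) (fun x => by
      obtain ⟨r, hr⟩ := hA x
      exact ⟨r, by rw [← Nat.cast_pow, Nat.cast_smul_eq_nsmul]; exact hr⟩) n γ
  exact ⟨m, by rw [← Nat.cast_smul_eq_nsmul ℤ, Nat.cast_pow]; exact hm⟩

variable {K : Type} [Field K] [NumberField K]

omit [NumberField K] in
/-- The `N_S`-invariants of a `p`-primary module are `p`-primary. [folklore] -/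
private theorem isPrimaryTorsion_invariantsOf {M : Type} [AddCommGroup M] [TopologicalSpace M]
    [DiscreteTopology M] (ρ : DiscreteGaloisModule K M) (N : Subgroup (absoluteGaloisGroup K))
    {p : ℕ} (hM : IsPrimaryTorsion p M) : IsPrimaryTorsion p (ContinuousRep.invariantsOf N ρ) :=
  fun w => by
    obtain ⟨r, hr⟩ := hM (w : M)
    exact ⟨r, Subtype.ext (by rw [AddSubmonoidClass.coe_nsmul, ZeroMemClass.coe_zero]; exact hr)⟩

/-- **`Hⁿ(G_S, M)` is `p`-primary** for a `p`-primary discrete `Γ_K`-module `M`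
(`restrictedCohomology` currency). [cite: SerreGaloisCohomology1997, I §2.2 (Prop. 8, Cor. 3)] -/
theorem isPrimaryTorsion_restrictedCohomology {M : Type} [AddCommGroup M] [TopologicalSpace M]
    [DiscreteTopology M] (ρ : DiscreteGaloisModule K M) (S : Set (HeightOneSpectrum (𝓞 K)))
    {p : ℕ} (hM : IsPrimaryTorsion p M) (n : ℕ) : IsPrimaryTorsion p (restrictedCohomology ρ S n) :=
  isPrimaryTorsion_continuousCohomology
    (ContinuousRep.quotientInvariants (ramificationSubgroup K S) ρ)
    (isPrimaryTorsion_invariantsOf ρ _ hM) n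

/-- **`#Hⁿ(G_S, M) = p^k`** for a `p`-primary discrete `Γ_K`-module `M` with `Hⁿ(G_S, M)` finite.
[cite: SerreGaloisCohomology1997, I §2.2 (Prop. 8, Cor. 3)] -/
theorem exists_natCard_restrictedCohomology_eq_pow {M : Type} [AddCommGroup M] [TopologicalSpace M]
    [DiscreteTopology M] (ρ : DiscreteGaloisModule K M) (S : Set (HeightOneSpectrum (𝓞 K)))
    (p : ℕ) [Fact p.Prime] (hM : IsPrimaryTorsion p M) (n : ℕ) [Finite (restrictedCohomology ρ S n)] :
    ∃ k : ℕ, Nat.card (restrictedCohomology ρ S n) = p ^ k :=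
  exists_card_eq_prime_pow _ (isPrimaryTorsion_restrictedCohomology ρ S hM n)

end Torsion

/-! ### §2. Arithmetic: from the cleared-denominator identity to additivity of valuations -/

section Arithmetic

/-- **From `(a₂·c₂·m₂^e)·b₁·b₃ = b₂·(a₁·c₁·m₁^e)·(a₃·c₃·m₃^e)` to `χ₂ = χ₁ + χ₃`**, where
`χᵢ = v_p aᵢ − v_p bᵢ + v_p cᵢ + e·v_p mᵢ ∈ ℤ`, for non-zero naturals (the passage from Milne's
multiplicative `φ` to an additive invariant). [cite: MilneADT2006, I §5 Lemma 5.3 (p. 69)] -/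
theorem padicValNat_euler_add_of_card_nineTerm (p : ℕ) [Fact p.Prime]
    {a₁ b₁ c₁ m₁ a₂ b₂ c₂ m₂ a₃ b₃ c₃ m₃ : ℕ} (e : ℕ)
    (ha₁ : a₁ ≠ 0) (hb₁ : b₁ ≠ 0) (hc₁ : c₁ ≠ 0) (hm₁ : m₁ ≠ 0)
    (ha₂ : a₂ ≠ 0) (hb₂ : b₂ ≠ 0) (hc₂ : c₂ ≠ 0) (hm₂ : m₂ ≠ 0)
    (ha₃ : a₃ ≠ 0) (hb₃ : b₃ ≠ 0) (hc₃ : c₃ ≠ 0) (hm₃ : m₃ ≠ 0)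
    (h : a₂ * c₂ * m₂ ^ e * b₁ * b₃ = b₂ * (a₁ * c₁ * m₁ ^ e) * (a₃ * c₃ * m₃ ^ e)) :
    ((padicValNat p a₂ : ℤ) - padicValNat p b₂ + padicValNat p c₂ + e * padicValNat p m₂) =
      ((padicValNat p a₁ : ℤ) - padicValNat p b₁ + padicValNat p c₁ + e * padicValNat p m₁) +
        ((padicValNat p a₃ : ℤ) - padicValNat p b₃ + padicValNat p c₃ + e * padicValNat p m₃) := by
  have hv := congrArg (padicValNat p) h
  have hm₁e : m₁ ^ e ≠ 0 := pow_ne_zero _ hm₁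
  have hm₂e : m₂ ^ e ≠ 0 := pow_ne_zero _ hm₂
  have hm₃e : m₃ ^ e ≠ 0 := pow_ne_zero _ hm₃
  rw [padicValNat.mul (mul_ne_zero (mul_ne_zero (mul_ne_zero ha₂ hc₂) hm₂e) hb₁) hb₃,
    padicValNat.mul (mul_ne_zero (mul_ne_zero ha₂ hc₂) hm₂e) hb₁,
    padicValNat.mul (mul_ne_zero ha₂ hc₂) hm₂e, padicValNat.mul ha₂ hc₂,
    padicValNat.mul (mul_ne_zero hb₂ (mul_ne_zero (mul_ne_zero ha₁ hc₁) hm₁e))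
      (mul_ne_zero (mul_ne_zero ha₃ hc₃) hm₃e),
    padicValNat.mul hb₂ (mul_ne_zero (mul_ne_zero ha₁ hc₁) hm₁e),
    padicValNat.mul (mul_ne_zero ha₁ hc₁) hm₁e, padicValNat.mul ha₁ hc₁,
    padicValNat.mul (mul_ne_zero ha₃ hc₃) hm₃e, padicValNat.mul ha₃ hc₃,
    padicValNat.pow, padicValNat.pow, padicValNat.pow] at hv
  push_cast
  linarith [(by exact_mod_cast hv :
    ((padicValNat p a₂ : ℤ) + padicValNat p c₂ + e * padicValNat p m₂ + padicValNat p b₁ +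
        padicValNat p b₃ =
      padicValNat p b₂ + (padicValNat p a₁ + padicValNat p c₁ + e * padicValNat p m₁) +
        (padicValNat p a₃ + padicValNat p c₃ + e * padicValNat p m₃)))]

/-- **`a·c·m^e = b` iff `v_p a − v_p b + v_p c + e·v_p m = 0`** when `a, b, c, m` are powers of
`p`. [cite: MilneADT2006, I §5 Thm. 5.1 (p. 67)] -/
theorem pow_euler_iff_padicValNat (p : ℕ) [hp : Fact p.Prime] {a b c m : ℕ} (e : ℕ)
    (ha : ∃ k, a = p ^ k) (hb : ∃ k, b = p ^ k) (hc : ∃ k, c = p ^ k) (hm : ∃ k, m = p ^ k) :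
    a * c * m ^ e = b ↔
      ((padicValNat p a : ℤ) - padicValNat p b + padicValNat p c + e * padicValNat p m) = 0 := by
  obtain ⟨α, rfl⟩ := ha
  obtain ⟨β, rfl⟩ := hb
  obtain ⟨γ, rfl⟩ := hc
  obtain ⟨μ, rfl⟩ := hm
  rw [padicValNat.prime_pow, padicValNat.prime_pow, padicValNat.prime_pow, padicValNat.prime_pow,
    ← pow_mul, ← pow_add, ← pow_add]
  constructor
  · intro h
    have h' : α + γ + μ * e = β := Nat.pow_right_injective hp.out.two_le h
    have hz : ((α : ℤ) + γ + μ * e) = β := by exact_mod_cast h'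
    linarith
  · intro h
    have hz : ((α : ℤ) + γ + μ * e) = β := by linarith
    have h' : α + γ + μ * e = β := by exact_mod_cast hz
    rw [h']

end Arithmetic

/-! ### §3. Additivity of `χ_{p,e}` along a short exact sequence (`K` totally complex) -/

section Additivity

variable {K : Type} [Field K] [NumberField K] [IsTotallyComplex K] {S : Set (HeightOneSpectrum (𝓞 K))}
variable {M₁ M₂ M₃ : Type}
  [AddCommGroup M₁] [TopologicalSpace M₁] [DiscreteTopology M₁]
  [AddCommGroup M₂] [TopologicalSpace M₂] [DiscreteTopology M₂]
  [AddCommGroup M₃] [TopologicalSpace M₃] [DiscreteTopology M₃]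

/-- **Milne I Lemma 5.3, additive form: `χ_{p,e}(M₂) = χ_{p,e}(M₁) + χ_{p,e}(M₃)`**, where
`χ_{p,e}(M) = v_p #H⁰(G_S, M) − v_p #H¹(G_S, M) + v_p #H²(G_S, M) + e·v_p #M`
(`Hⁿ(G_S, M) = restrictedCohomology ρ S n`), for `K` totally complex, `S ⊇ S_p` finite, a short exact
sequence `0 → M₁ → M₂ → M₃ → 0` of discrete `Γ_K`-modules with `M₂` finite and unramified outside
`S`, `M₃` finite, `M₁` `p`-primary, and `H²(G_S, M₁)`, `H²(G_S, M₂)` finite (`H⁰`, `H¹` are finite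
unconditionally; `H²(G_S, M₃)` is then finite, `IsSES.finite_two_X₃`).
[cite: MilneADT2006, I §5 Lemma 5.3 (p. 69)] [cite: NeukirchSchmidtWingberg2008, (8.3.18)] -/
theorem restrictedCohomology_eulerChar_add (hSfin : S.Finite) (p : ℕ) [Fact p.Prime]
    (hSp : ∀ v : HeightOneSpectrum (𝓞 K), ((p : ℕ) : 𝓞 K) ∈ v.asIdeal → v ∈ S)
    [Finite M₂] [Finite M₃]
    {ρ₁ : DiscreteGaloisModule K M₁} {ρ₂ : DiscreteGaloisModule K M₂} {ρ₃ : DiscreteGaloisModule K M₃}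
    {f : ρ₁.toTopRep ⟶ ρ₂.toTopRep} {g : ρ₂.toTopRep ⟶ ρ₃.toTopRep} (h : IsSES f g)
    (hur : GaloisRep.IsUnramifiedOutside S ρ₂) (hM₁ : IsPrimaryTorsion p M₁)
    [Finite (restrictedCohomology ρ₁ S 2)] [Finite (restrictedCohomology ρ₂ S 2)] (e : ℕ) :
    ((padicValNat p (Nat.card (restrictedCohomology ρ₂ S 0)) : ℤ) -
          padicValNat p (Nat.card (restrictedCohomology ρ₂ S 1)) +
          padicValNat p (Nat.card (restrictedCohomology ρ₂ S 2)) +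
        e * padicValNat p (Nat.card M₂)) =
      ((padicValNat p (Nat.card (restrictedCohomology ρ₁ S 0)) : ℤ) -
            padicValNat p (Nat.card (restrictedCohomology ρ₁ S 1)) +
            padicValNat p (Nat.card (restrictedCohomology ρ₁ S 2)) +
          e * padicValNat p (Nat.card M₁)) +
        ((padicValNat p (Nat.card (restrictedCohomology ρ₃ S 0)) : ℤ) -
            padicValNat p (Nat.card (restrictedCohomology ρ₃ S 1)) +
            padicValNat p (Nat.card (restrictedCohomology ρ₃ S 2)) +
          e * padicValNat p (Nat.card M₃)) := by
  haveI : Finite M₁ := Finite.of_injective _ h.injective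
  have hur₁ := isUnramifiedOutside_X₁ h S hur
  have hur₃ := isUnramifiedOutside_X₃ h S hur
  have hS := isSES_invariantsHom_ramificationSubgroup h S hur
  haveI : Subsingleton (continuousCohomology 3
      (ContinuousRep.quotientInvariants (ramificationSubgroup K S) ρ₁).toTopRep) :=
    subsingleton_restrictedCohomology_of_isPrimaryTorsion_of_isTotallyComplex S p hSp ρ₁ hM₁
      (by norm_num)
  haveI h0₁ : Finite (restrictedCohomology ρ₁ S 0) := finite_restrictedCohomology_zero S ρ₁
  haveI h0₂ : Finite (restrictedCohomology ρ₂ S 0) := finite_restrictedCohomology_zero S ρ₂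
  haveI h0₃ : Finite (restrictedCohomology ρ₃ S 0) := finite_restrictedCohomology_zero S ρ₃
  haveI h1₁ : Finite (restrictedCohomology ρ₁ S 1) := finite_restrictedCohomology_one hSfin ρ₁
  haveI h1₂ : Finite (restrictedCohomology ρ₂ S 1) := finite_restrictedCohomology_one hSfin ρ₂
  haveI h1₃ : Finite (restrictedCohomology ρ₃ S 1) := finite_restrictedCohomology_one hSfin ρ₃
  haveI : Finite (continuousCohomology 1
      (ContinuousRep.quotientInvariants (ramificationSubgroup K S) ρ₁).toTopRep) := h1₁
  haveI : Finite (continuousCohomology 1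
      (ContinuousRep.quotientInvariants (ramificationSubgroup K S) ρ₂).toTopRep) := h1₂
  haveI : Finite (continuousCohomology 1
      (ContinuousRep.quotientInvariants (ramificationSubgroup K S) ρ₃).toTopRep) := h1₃
  haveI : Finite (continuousCohomology 2
      (ContinuousRep.quotientInvariants (ramificationSubgroup K S) ρ₁).toTopRep) :=
    ‹Finite (restrictedCohomology ρ₁ S 2)›
  haveI : Finite (continuousCohomology 2
      (ContinuousRep.quotientInvariants (ramificationSubgroup K S) ρ₂).toTopRep) :=
    ‹Finite (restrictedCohomology ρ₂ S 2)›
  haveI h2₃ : Finite (restrictedCohomology ρ₃ S 2) := hS.finite_two_X₃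
  have E := hS.card_nineTerm_euler_zero e
  rw [natCard_invariantsOf_ramificationSubgroup ρ₁ S hur₁,
    natCard_invariantsOf_ramificationSubgroup ρ₂ S hur,
    natCard_invariantsOf_ramificationSubgroup ρ₃ S hur₃] at E
  exact padicValNat_euler_add_of_card_nineTerm p e
    Nat.card_pos.ne' Nat.card_pos.ne' Nat.card_pos.ne' Nat.card_pos.ne'
    Nat.card_pos.ne' Nat.card_pos.ne' Nat.card_pos.ne' Nat.card_pos.ne'
    Nat.card_pos.ne' Nat.card_pos.ne' Nat.card_pos.ne' Nat.card_pos.ne' E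

end Additivity

/-! ### §4. Tate's identity versus `χ_{p,e} = 0` -/

section Iff

variable {K : Type} [Field K] [NumberField K] {S : Set (HeightOneSpectrum (𝓞 K))}
variable {M : Type} [AddCommGroup M] [TopologicalSpace M] [DiscreteTopology M]

omit [NumberField K] [TopologicalSpace M] [DiscreteTopology M] in
/-- The order of a finite `p`-primary module is a power of `p`. [folklore] -/
private theorem exists_natCard_eq_pow_of_isPrimaryTorsion (p : ℕ) [Fact p.Prime] [Finite M]
    (hM : IsPrimaryTorsion p M) : ∃ k : ℕ, Nat.card M = p ^ k :=
  exists_card_eq_prime_pow M hM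

/-- **Tate's identity `#H⁰·#H²·#M^e = #H¹` holds iff `χ_{p,e}(ρ) = 0`**, for a finite `p`-primary
discrete `Γ_K`-module `M`, `S` finite, `H²(G_S, M)` finite (all four cardinalities are powers of
`p`). [cite: MilneADT2006, I §5 Thm. 5.1 (p. 67) and Lemma 5.3 (p. 69)] -/
theorem restrictedCohomology_euler_iff_eulerChar_eq_zero (hSfin : S.Finite) (p : ℕ) [Fact p.Prime]
    [Finite M] (ρ : DiscreteGaloisModule K M) (hM : IsPrimaryTorsion p M)
    [Finite (restrictedCohomology ρ S 2)] (e : ℕ) :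
    Nat.card (restrictedCohomology ρ S 0) * Nat.card (restrictedCohomology ρ S 2) * Nat.card M ^ e =
        Nat.card (restrictedCohomology ρ S 1) ↔
      ((padicValNat p (Nat.card (restrictedCohomology ρ S 0)) : ℤ) -
            padicValNat p (Nat.card (restrictedCohomology ρ S 1)) +
            padicValNat p (Nat.card (restrictedCohomology ρ S 2)) +
          e * padicValNat p (Nat.card M)) = 0 := by
  haveI := finite_restrictedCohomology_zero S ρ
  haveI := finite_restrictedCohomology_one hSfin ρ
  exact pow_euler_iff_padicValNat p e
    (exists_natCard_restrictedCohomology_eq_pow ρ S p hM 0)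
    (exists_natCard_restrictedCohomology_eq_pow ρ S p hM 1)
    (exists_natCard_restrictedCohomology_eq_pow ρ S p hM 2)
    (exists_natCard_eq_pow_of_isPrimaryTorsion p hM)

end Iff

end Literature.NumberTheory.GaloisCohomology

end
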